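import Literature.NumberTheory.Automorphic.Liu2021.LocalNormClassFlip
import Summits.HodgeConjecture.HodgeConjecture.Theorems.F0LD2ArchAdmissibleAssembly
import Literature.NumberTheory.ComplexMultiplication.CMTypeBasic
import Literature.NumberTheory.Rogawski1990.CurveThetaHodgeTypeNecessity
import HarnessLib

/-!
# LD2 organ ARITH₂ — «raw archimedean sign table + label dichotomy + pin `e♮ ∈ Φ_λ` ⇒ `Φ_λ` is admissible for `ε_a`»
# (the arithmetic tail of G2 `F0P5CurveThetaLettersPaydown.PinnedHolNecessity₂` under the printed stub #74
# `Rogawski1990.curveThetaHodgeTypeNecessity_hol` = socket `stub_S1b_facts` of `Cruxes/HLiu418/Lines/F0_AlbCm.lean`)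

Cell `hodgecm-mathlib`, half A line LD2 (socket 27458 `stub_S1b_facts`, books #74 E3nec-hol [Liu2021, Rem. D.5 ⇒]), seat LD2-p01 (g0),
2026-09-02.  THEOREMS ONLY (no `def`, no `sorry`, no instance, no notation); `--supports stmt-HodgeConjecture-24832`.

WHAT IT IS.  The in-house residue of `stub_S1b_facts` is G2 = [Liu2021, Rem. D.5] (necessity, label pinned) through the ★ certificate
`paydownCertificate₇₄ : G2 → R2′ → R1 → A → #74`.  On the theta road at `n = 2` (the T5 seam ★ `MeetsThetaLiftFromLine L 2 …` of
`Liu2021/ThetaLiftFromLineMeets`), G2 is assembled from four organs — A₂ (th:pole: a `(1,0)`-type discrete `P` with θ-type finite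
component meets the theta lift from SOME line `⟨a′⟩` at SOME conjugate-symplectic `μ′`), B₂ (its finite component is `ω(μ′, ε_{a′}, χ′)_f`),
C₂ (the RAW archimedean table of [Liu2021, Lem. D.2 (3) at the `(1,1)`-place, (1) at the definite places]), U₂ (the GLOBAL label dichotomy
[Liu2021, proof of Prop. D.4 (1), p. 131 L1–2]: `(λ, ε_a, χ)` is `(μ′, ε_{a′}, χ′)` or its companion `(μ′ᶜχ̌′, ε′, χ′)`) — and THIS arithmetic
tail, which turns their outputs into G2's conclusion `∃ e, IsAdmissibleElement L Φ_λ e ∧ epsOf … (2·imagUnit L)⁻¹ e = locF … a`.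

THE n = 2 PIN SUBTLETY (why this organ case-splits).  [Liu2021, Lem. D.2 (3), p. 127]: «if `n = 2`, then in the set `{ω_{1,1}^{m,±,l}}`, only
`ω_{1,1}^{−1,−,0}` AND `ω_{1,1}^{1,−,0}` are isomorphic to `π^{1,0}_{1,1}`» — at the `(1,1)`-place a holomorphic occurrence forces the SIGN
`Im e♮(a′δ′) < 0` for BOTH weights `m₁ = ±1`, i.e. it does NOT pin `e♮ ∈ Φ_{μ′}`.  Hence «`a′δ′` is `Φ_{μ′}`-admissible» may FAIL (when
`ē♮ ∈ Φ_{μ′}`: then the companion triple is the one of [Liu2021, Prop. D.4 (1)]), and the admissible witness for `Φ_λ` is: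
* case `(λ, a) = (μ′, a′)` (so `e♮ ∈ Φ_{μ′}` by the pin): `e := a′·δ′` itself (★ `F0LD2ArchAdmissibleAssembly.isAdmissibleElement_of_pin_of_archSigns`, LD2-p02 (g0), p848163);
* case companion (`Φ_λ = Φ̄_{μ′}`, the classes of `a` and `a′` differ EXACTLY at the anisotropic finite places of the registered plane):
  `e := θ·a′δ′` with `θ ∈ L⁺` flipping the local norm class exactly at the anisotropic finite places and the sign at the `[L⁺:ℚ] − 1` real
  places away from `ι` — it exists by [Omeara1963, 71:19] because that set has EVEN cardinality ([Liu2021, App. D §D.3]: Hilbert reciprocity,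
  ★ `RemD5.even_ncard_not_isIsotropic_add_finrank_sub_one`); in the tree this is ★ `RemD5.isAdmissible_flip_bar_of_flip` read through
  ★ `CMTypeOps.bar_flip` ∕ `flip_flip` (`flip_p (bar (flip_p Ψ)) = bar Ψ`).

FRAME.  Binders = the ARITHMETIC tokens of G2 only (`L`, `ι`, the real diagonal frame `dV` with its signature clause, `Φ := hlam.cmType`,
`a`), plus the outputs of C₂∕U₂ as hypotheses over a second CM type `Φ′` (`:= hμ′.cmType`) and a line `a′`: NO automorphic object appears.
HEAD `pinToAdmissible₂_holds` (§2) = the organ `PinToAdmissible₂` of LD2-plan (g0)'s skeleton `StubS1bfacts.inhouse.skeleton.v2` :398 TOKEN FOR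
TOKEN (pin at `e♮ := (cmPlace L ι).1.embedding`; C₂away in the implication currency `τ′ ∈ Φ′ → Im τ′(e′) < 0`); §1 is the companion case over a
generic embedding `p` above the place of `ι`; the same-label case and the dictionary `epsOf (a′δ′) = locF a′` are ★ BY NAME from
LD2-p02's `Theorems/F0LD2ArchAdmissibleAssembly` (p848163); the RAW `exponentAt` currency of ★ `ThetaLiftFromLineArchTypes` is bridged there too (`Φ_μ = {τ′ ∣ exponentAt < 0}`: ★ `F0LD2ArchAdmissibleAssembly.isAdmissibleElement_cmType_of_pin_of_archTable`).

HONEST LABEL.  HC_CM is proved only modulo the 7 printed citations (2 remaining: hLiu418 = stmt-HodgeConjecture-24832, h413 =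
stmt-HodgeConjecture-24833) until rung 0 closes; this file discharges none of them — it is one organ of the in-house road for #74.

## References
* [Liu2021] Y. Liu, *Fourier–Jacobi cycles and arithmetic relative trace formula*, Camb. J. Math. 9 (2021) = arXiv:2102.11518: App. D Rem. D.5
  (p. 131), Prop. D.4 (1) and its proof (pp. 130–131), Lem. D.2 (1), (3) (p. 127), Lem. D.1 (4) (p. 126), Def. 4.12 (p. 47), App. D §D.3.
* [Omeara1963] O. T. O'Meara, *Introduction to Quadratic Forms* (1963), §71 Thm. 71:18, 71:19.
-/

set_option autoImplicit false
set_option linter.dupNamespace false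

noncomputable section

open NumberField NumberField.InfinitePlace NumberField.ComplexEmbedding IsDedekindDomain
open scoped Matrix ComplexOrder
open Literature.NumberTheory.Automorphic Literature.NumberTheory.Automorphic.UnitaryGroup
open Literature.NumberTheory.Automorphic.Liu2021 Literature.NumberTheory.Automorphic.Liu2021.Def411WeilCarriers
open Literature.NumberTheory.Automorphic.Liu2021.RemD5
open Literature.NumberTheory.Automorphic.IdeleClassGroup
open Literature.AlgebraicGeometry.Liu2021 (IsAdmissibleElement)
open Literature.AlgebraicGeometry.Motives (CMType)
open Literature.NumberTheory.ComplexMultiplication (CMTypeOps.bar CMTypeOps.flip CMTypeOps.placeSet CMTypeOps.mem_bar_iff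
  CMTypeOps.mem_flip_iff CMTypeOps.flip_flip CMTypeOps.mem_iff_conjugate_notMem)
open Literature.NumberTheory.GelbartRogawski1991 Literature.NumberTheory.GelbartRogawski1991.UnitaryDualPair

namespace Summit.HodgeConjecture.HodgeConjecture.Cruxes.HLiu418.F0LD2PinToAdmissible

variable {L : Type} [Field L] [NumberField L] [IsCMField L]

/-! ## §1 Case «companion label»: flip along the anisotropic set (O'Meara 71:19 + Hilbert reciprocity) -/

omit [IsCMField L] in
/-- `#{infinite places of L⁺} = [L⁺ : ℚ]` (totally real), as the parity conversion `Even (n + ([L⁺:ℚ] − 1)) → Odd (n + #places)`. [folklore] -/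
theorem odd_add_card_infinitePlace_of_even (n : ℕ) (h : Even (n + (Module.finrank ℚ (↥(maximalRealSubfield L)) - 1))) :
    Odd (n + Fintype.card (InfinitePlace (↥(maximalRealSubfield L)))) := by
  have hcard : Fintype.card (InfinitePlace (↥(maximalRealSubfield L))) = Module.finrank ℚ (↥(maximalRealSubfield L)) := by
    rw [card_eq_nrRealPlaces_add_nrComplexPlaces, IsTotallyReal.nrComplexPlaces_eq_zero, add_zero, ← IsTotallyReal.finrank]
  have hpos : 1 ≤ Module.finrank ℚ (↥(maximalRealSubfield L)) := Module.finrank_pos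
  rw [hcard, Nat.odd_iff]
  rw [Nat.even_iff] at h
  omega

omit [NumberField L] [IsCMField L] in
/-- `Φ̄̄ = Φ`. [folklore] -/
theorem bar_bar (Φ : CMType L) : CMTypeOps.bar (CMTypeOps.bar Φ) = Φ :=
  Subtype.ext (compl_compl Φ.1)

/-- **Case companion.**  Registered frame (`ι`; real diagonal `dV` of signature `(1,1)` at `ι`, definite elsewhere); `Ψ` a CM type and
`a′` a line such that `a′δ′` is `Ψ^{(p)}`-admissible (`Ψ^{(p)} = CMTypeOps.flip p Ψ`: «negative at the members of `Ψ` away from `ι`, negative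
at `p`» when `p̄ ∈ Ψ`); `a` a line whose local norm classes agree with those of `a′` EXACTLY at the isotropic finite places of the plane.  Then
`Ψ̄` is admissible for `ε_a`: some `e` with `Im φ(e) < 0` on `Ψ̄` has collection `locF a` (★ `RemD5.isAdmissible_flip_bar_of_flip` at
`Φ := flip p Ψ`, read through ★ `bar_flip`, `flip_flip`; parity ★ `even_ncard_not_isIsotropic_add_finrank_sub_one`).
[cite: Liu2021, App. D §D.3; Lem. D.1 (4) p. 126; Def. 4.12 p. 47] [cite: Omeara1963, §71 Thm. 71:19] -/
theorem exists_isAdmissibleElement_bar_of_flip_on_anisotropic (ι : L →+* ℂ)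
    (dV : Fin 2 → L) (hdV : ∀ i, IsCMField.complexConj L (dV i) = dV i) (hdV0 : ∀ i, dV i ≠ 0)
    (hsig : (∃ T : GL (Fin 2) ℂ, formCongr (starRingEnd ℂ) T ((Matrix.diagonal dV).map ι) = Matrix.diagonal ![(1 : ℂ), -1]) ∧
      ∀ τ' : L →+* ℂ, InfinitePlace.mk τ' ≠ InfinitePlace.mk ι → ((Matrix.diagonal dV).map τ').PosDef)
    (hJh : ((Matrix.diagonal dV).map (IsCMField.complexConj L))ᵀ = Matrix.diagonal dV) (hJdet : (Matrix.diagonal dV).det ≠ 0)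
    (Ψ : CMType L) (p : L →+* ℂ) (a a' : (↥(maximalRealSubfield L))ˣ)
    (hadm' : IsAdmissibleElement L (CMTypeOps.flip p Ψ).1 (algebraMap (↥(maximalRealSubfield L)) L a' * (2 * imagUnit L)⁻¹))
    (hcl : ∀ v : HeightOneSpectrum (𝓞 ↥(maximalRealSubfield L)),
      locF (↥(maximalRealSubfield L)) (imagUnitSq L) a' v = locF (↥(maximalRealSubfield L)) (imagUnitSq L) a v ↔
        LemD1.IsIsotropic (LemD1OfPlace.standingData L v (IsCMField.complexConj L) 2 (Matrix.diagonal dV)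
          (complexConj_imagUnit L) (imagUnit_ne_zero L) le_rfl hJh hJdet)) :
    ∃ e : L, IsAdmissibleElement L (CMTypeOps.bar Ψ).1 e ∧
      epsOf (↥(maximalRealSubfield L)) (imagUnitSq L) L (2 * imagUnit L)⁻¹ e = locF (↥(maximalRealSubfield L)) (imagUnitSq L) a := by
  -- the real diagonal `t` with `diag dV = diag t ⊗ 1`
  let t : Fin 2 → ↥(maximalRealSubfield L) := fun i => ⟨dV i, (IsCMField.complexConj_eq_self_iff (K := L) (dV i)).1 (hdV i)⟩
  have hJ : Matrix.diagonal dV = (Matrix.diagonal t).map (algebraMap (↥(maximalRealSubfield L)) L) := by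
    rw [Matrix.diagonal_map (map_zero _)]; rfl
  have ht : ∀ i, t i ≠ 0 := fun i h => hdV0 i (congrArg Subtype.val h)
  set T : Set (HeightOneSpectrum (𝓞 ↥(maximalRealSubfield L))) := {v | ¬ LemD1.IsIsotropic
    (LemD1OfPlace.standingData L v (IsCMField.complexConj L) 2 (Matrix.diagonal dV) (complexConj_imagUnit L) (imagUnit_ne_zero L)
      le_rfl hJh hJdet)} with hTdef
  have hd : imagUnit L * imagUnit L = algebraMap (↥(maximalRealSubfield L)) L (imagUnitSq L) := imagUnit_mul_self L
  have hTfin : T.Finite :=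
    LemD1OfPlace.finite_setOf_not_isIsotropic L (IsCMField.complexConj L) (complexConj_imagUnit L) (imagUnit_ne_zero L) t hJ hJh
      hJdet hd ht
  have hpar : Even (T.ncard + (Module.finrank ℚ (↥(maximalRealSubfield L)) - 1)) :=
    even_ncard_not_isIsotropic_add_finrank_sub_one L ι dV hdV hdV0 hsig (complexConj_imagUnit L) (imagUnit_ne_zero L) hJh hJdet
  have hns : ∀ v ∈ T, ¬ IsSquare (algebraMap (↥(maximalRealSubfield L)) (v.adicCompletion (↥(maximalRealSubfield L))) (imagUnitSq L)) :=
    fun v hv => not_isSquare_of_not_isIsotropic L v (IsCMField.complexConj L) (complexConj_imagUnit L) (imagUnit_ne_zero L) t hJ hJh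
      hJdet hd ht hv
  have hd0 : imagUnitSq L ≠ 0 := fun h => by
    have h' := hd
    rw [h, map_zero, mul_self_eq_zero] at h'
    exact imagUnit_ne_zero L h'
  have hdneg : ∀ (w : InfinitePlace (↥(maximalRealSubfield L))) (hw : w.IsReal),
      InfinitePlace.embedding_of_isReal hw (imagUnitSq L) < 0 :=
    fun w hw => embedding_of_isReal_lt_zero_of_coe_eq_mul_self (complexConj_imagUnit L) (imagUnit_ne_zero L) hd.symm w hw
  -- the normaliser `δ′ = (2·imagUnit L)⁻¹` is purely imaginary and non-zero
  have h2δ : (2 : L) * imagUnit L ≠ 0 := mul_ne_zero two_ne_zero (imagUnit_ne_zero L)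
  have hδ0 : (2 * imagUnit L)⁻¹ ≠ 0 := inv_ne_zero h2δ
  have hδ : IsCMField.complexConj L ((2 * imagUnit L)⁻¹) = -(2 * imagUnit L)⁻¹ := by
    rw [map_inv₀, map_mul, map_ofNat, complexConj_imagUnit, mul_neg, inv_neg]
  -- flip hypotheses for `ε := locF a′`, `ε′ := locF a` on `T`
  have hoff : ∀ v ∉ T, locF (↥(maximalRealSubfield L)) (imagUnitSq L) a v = locF (↥(maximalRealSubfield L)) (imagUnitSq L) a' v := by
    intro v hv
    have hv' : LemD1.IsIsotropic (LemD1OfPlace.standingData L v (IsCMField.complexConj L) 2 (Matrix.diagonal dV)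
        (complexConj_imagUnit L) (imagUnit_ne_zero L) le_rfl hJh hJdet) := by
      simpa [hTdef] using hv
    exact ((hcl v).2 hv').symm
  have hon' : ∀ v ∈ T, locF (↥(maximalRealSubfield L)) (imagUnitSq L) a v ≠ locF (↥(maximalRealSubfield L)) (imagUnitSq L) a' v := by
    intro v hv h
    have hv' : ¬ LemD1.IsIsotropic (LemD1OfPlace.standingData L v (IsCMField.complexConj L) 2 (Matrix.diagonal dV)
        (complexConj_imagUnit L) (imagUnit_ne_zero L) le_rfl hJh hJdet) := by
      simpa [hTdef] using hv
    exact hv' ((hcl v).1 h.symm)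
  have hon := flip_hypotheses_of_ne_on (imagUnitSq L) (locF (↥(maximalRealSubfield L)) (imagUnitSq L) a')
    (locF (↥(maximalRealSubfield L)) (imagUnitSq L) a) T hns hon'
  have hadm : ∃ e : L, IsAdmissibleElement L (CMTypeOps.flip p Ψ).1 e ∧
      epsOf (↥(maximalRealSubfield L)) (imagUnitSq L) L (2 * imagUnit L)⁻¹ e = locF (↥(maximalRealSubfield L)) (imagUnitSq L) a' :=
    ⟨_, hadm', F0LD2ArchAdmissibleAssembly.epsOf_lineDisc L a'⟩
  have key := isAdmissible_flip_bar_of_flip (CMTypeOps.flip p Ψ) p hδ hδ0 (imagUnitSq L) hd0 hdneg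
    (locF (↥(maximalRealSubfield L)) (imagUnitSq L) a') (locF (↥(maximalRealSubfield L)) (imagUnitSq L) a) hTfin hoff hon
    (odd_add_card_infinitePlace_of_even _ hpar) hadm
  simpa only [bar_flip, CMTypeOps.flip_flip] using key

/-! ## §2 The organ ARITH₂ `PinToAdmissible₂` of the LD2 skeleton (LD2-plan (g0) `StubS1bfacts.inhouse.skeleton.v2` :398) — HEAD -/

/-- **ARITH₂ HOLDS — the LD2 organ `PinToAdmissible₂` (skeleton v1 :388 = v2 :398, token for token).**  Registered frame of #74 ∕ G2 (`ι`; `dV` real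
diagonal, signature `(1,1)` at `ι` and definite elsewhere; `[L:ℚ] ≥ 4`); `Φ` (`= Φ_λ`) with the PIN `e♮ ∈ Φ`, `e♮ := (cmPlace L ι).1.embedding`; `Φ′`
(`= Φ_{μ′}`); the outputs of C₂at (`Im e♮(a′δ′) < 0`, [Liu2021, Lem. D.2 (3)] — no weight pin at `n = 2`), of C₂away read through `Φ′` (`Im τ′(a′δ′) < 0`
for `τ′ ∈ Φ′` off the place of `ι`, [Liu2021, Lem. D.2 (1)]) and of U₂ (`Φ′ = Φ` with equal collections, or `Φ′ = Φ̄` with collections equal exactly at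
the isotropic finite places, [Liu2021, proof of Prop. D.4 (1) p. 131 L1–2; Lem. D.1 (4)]).  CONCLUSION = G2's: `Φ` is admissible for `ε_a`
(`∃ e, IsAdmissibleElement L Φ e ∧ epsOf … (2·imagUnit L)⁻¹ e = locF … a`).  Case `Φ′ = Φ`: `e := a′δ′` (★ p848163); case `Φ′ = Φ̄`: §1 at `Ψ := Φ′`.
The skeleton closes `stub_pinToAdmissible₂ := pinToAdmissible₂_holds` by `δ`.
[cite: Liu2021, App. D Rem. D.5 p. 131; Prop. D.4 (1) proof pp. 130–131; Lem. D.2 (1), (3) p. 127; Lem. D.1 (4) p. 126; Def. 4.12 p. 47; §D.3]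
[cite: Omeara1963, §71 Thm. 71:19] -/
theorem pinToAdmissible₂_holds :
  ∀ (L : Type) [Field L] [NumberField L] [IsCMField L] (ι : L →+* ℂ)
    (dV : Fin 2 → L) (hdV : ∀ i, IsCMField.complexConj L (dV i) = dV i) (hdV0 : ∀ i, dV i ≠ 0),
    (∃ T : GL (Fin 2) ℂ, formCongr (starRingEnd ℂ) T ((Matrix.diagonal dV).map ι) = Matrix.diagonal ![(1 : ℂ), -1]) →
    (∀ τ' : L →+* ℂ, InfinitePlace.mk τ' ≠ InfinitePlace.mk ι → ((Matrix.diagonal dV).map τ').PosDef) →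
    4 ≤ Module.finrank ℚ L →
    ∀ (Φ Φ' : CMType L) (a a' : (↥(maximalRealSubfield L))ˣ),
      (cmPlace L ι).1.embedding ∈ Φ.1 →
      ((cmPlace L ι).1.embedding (algebraMap (↥(maximalRealSubfield L)) L a' * (2 * imagUnit L)⁻¹)).im < 0 →
      (∀ τ' : L →+* ℂ, InfinitePlace.mk τ' ≠ InfinitePlace.mk ι → τ' ∈ Φ'.1 →
          (τ' (algebraMap (↥(maximalRealSubfield L)) L a' * (2 * imagUnit L)⁻¹)).im < 0) →
      ((Φ' = Φ ∧
          ∀ v : HeightOneSpectrum (𝓞 ↥(maximalRealSubfield L)),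
            locF (↥(maximalRealSubfield L)) (imagUnitSq L) a' v = locF (↥(maximalRealSubfield L)) (imagUnitSq L) a v) ∨
        (Φ' = CMTypeOps.bar Φ ∧
          ∀ (hJh : ((Matrix.diagonal dV).map (IsCMField.complexConj L))ᵀ = Matrix.diagonal dV) (hJdet : (Matrix.diagonal dV).det ≠ 0)
            (v : HeightOneSpectrum (𝓞 ↥(maximalRealSubfield L))),
            locF (↥(maximalRealSubfield L)) (imagUnitSq L) a' v = locF (↥(maximalRealSubfield L)) (imagUnitSq L) a v ↔
              LemD1.IsIsotropic (LemD1OfPlace.standingData L v (IsCMField.complexConj L) 2 (Matrix.diagonal dV)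
                (complexConj_imagUnit L) (imagUnit_ne_zero L) le_rfl hJh hJdet))) →
      ∃ e : L, IsAdmissibleElement L Φ.1 e ∧
        epsOf (↥(maximalRealSubfield L)) (imagUnitSq L) L (2 * imagUnit L)⁻¹ e = locF (↥(maximalRealSubfield L)) (imagUnitSq L) a := by
  intro L _ _ _ ι dV hdV hdV0 hsig₁ hsig₂ _ Φ Φ' a a' hpin hat haway hdich
  -- `p := e♮` lies over the place of `ι`
  have hp : InfinitePlace.mk (cmPlace L ι).1.embedding = InfinitePlace.mk ι := InfinitePlace.mk_embedding _
  rcases hdich with ⟨hΦ, hcl⟩ | ⟨hΦ, hcl⟩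
  · -- same label: `e := a′δ′`
    subst hΦ
    obtain ⟨hne, hskew⟩ := F0LD2ArchAdmissibleAssembly.lineDisc_ne_zero_and_skew L a'
    refine ⟨_, F0LD2ArchAdmissibleAssembly.isAdmissibleElement_of_pin_of_archSigns Φ' (cmPlace L ι).1 hne hskew hpin hat
      (fun τ' hτ' hmem => haway τ' (by rwa [show ((cmPlace L ι).1 : InfinitePlace L) = InfinitePlace.mk ι from rfl] at hτ') hmem), ?_⟩
    rw [F0LD2ArchAdmissibleAssembly.epsOf_lineDisc]
    exact funext hcl
  · -- companion label: `a′δ′` is `flip e♮ Φ′`-admissible, then flip along the anisotropic set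
    subst hΦ
    have hpΨ : (cmPlace L ι).1.embedding ∉ (CMTypeOps.bar Φ).1 := fun h => (CMTypeOps.mem_bar_iff Φ _).1 h hpin
    obtain ⟨hne, hskew⟩ := F0LD2ArchAdmissibleAssembly.lineDisc_ne_zero_and_skew L a'
    have hadm' : IsAdmissibleElement L (CMTypeOps.flip (cmPlace L ι).1.embedding (CMTypeOps.bar Φ)).1
        (algebraMap (↥(maximalRealSubfield L)) L a' * (2 * imagUnit L)⁻¹) := by
      refine F0LD2ArchAdmissibleAssembly.isAdmissibleElement_of_pin_of_archSigns _ (cmPlace L ι).1 hne hskew ?_ hat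
        (fun τ' hτ' hmem => ?_)
      · exact (CMTypeOps.mem_flip_iff _ _ _).2 (Or.inr ⟨Set.mem_insert _ _, hpΨ⟩)
      · -- away from `ι` the flipped type agrees with `Φ̄`
        have hτ'' : InfinitePlace.mk τ' ≠ InfinitePlace.mk ι := by
          rwa [show ((cmPlace L ι).1 : InfinitePlace L) = InfinitePlace.mk ι from rfl] at hτ'
        rcases (CMTypeOps.mem_flip_iff _ _ τ').1 hmem with ⟨h1, -⟩ | ⟨h1, -⟩
        · exact haway τ' hτ'' h1
        · exfalso
          apply hτ''
          rcases h1 with h | h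
          · rw [h, hp]
          · rw [h, InfinitePlace.mk_conjugate_eq, hp]
    -- hermitian ∕ non-degeneracy side conditions of the real diagonal frame
    have hJh : ((Matrix.diagonal dV).map (IsCMField.complexConj L))ᵀ = Matrix.diagonal dV := by
      rw [Matrix.diagonal_map (map_zero _), Matrix.diagonal_transpose]
      exact congrArg Matrix.diagonal (funext hdV)
    have hJdet : (Matrix.diagonal dV).det ≠ 0 := by
      rw [Matrix.det_diagonal]
      exact Finset.prod_ne_zero_iff.2 fun i _ => hdV0 i
    have key := exists_isAdmissibleElement_bar_of_flip_on_anisotropic ι dV hdV hdV0 ⟨hsig₁, hsig₂⟩ hJh hJdet (CMTypeOps.bar Φ)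
      (cmPlace L ι).1.embedding a a' hadm' (hcl hJh hJdet)
    rwa [bar_bar] at key

end Summit.HodgeConjecture.HodgeConjecture.Cruxes.HLiu418.F0LD2PinToAdmissible

end
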